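import Summits.QuantumFields.YangMills.Theses.AspectPurityFloor
import Summits.QuantumFields.YangMills.Theses.SlowBitWindow
import Summits.QuantumFields.YangMills.Theses.SwapTwistDeficit
import Summits.QuantumFields.YangMills.Theorems.LuscherReductionRunningReductionTraceFormula
import Summits.QuantumFields.YangMills.Theorems.FemtoTransferGapLevelsDecay
import Summits.QuantumFields.YangMills.Theorems.FemtoTransferGapLevelsPos
import Summits.QuantumFields.YangMills.Theorems.FemtoTransferGapBounds
import HarnessLib

/-!
# Route `AspectPurityFloor` (ym-idea-4 g19, LINE g19-A) — ENTROPY BRIDGE to the aspect-one few-body items of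
`SlowBitWindow` / `SwapTwistDeficit` (LINE g11-B of the same seat)

Sorry-free consequences of the zero-flux trace formula `Σ_k λ_k^T = Z_phys(T×L³)` (`TT.traceFormula_all`, T ≥ 2, β ≥ 1):

* `physTrace_le_participation_mul` — FEW-BODY AT ASPECT ONE FROM THE ASPECT-½ PARTICIPATION RATIO: for `β ≥ 1`, `L ≥ 4`,
  `t = ⌊L/2⌋`:  `Z(L×L³) ≤ (Z(t×L³)² / Z(2t×L³)) · λ₀^L`  (termwise `λ_k^L ≤ λ₀^{L−t} λ_k^t`, then `Z(t)/λ₀^t ≤ Z(t)²/Z(2t)` from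
  `Z(2t) ≤ λ₀^t Z(t)`).
* `subFemtoEntropyLaplaceWindow_of_windowPurityFloor : AspectPurityFloor.WindowPurityFloor → SlowBitWindow.SubFemtoEntropyLaplaceWindow`
  (⟨stmt-QuantumFields-23743⟩ ⇒ ⟨stmt-QuantumFields-23785⟩).
* `subFemtoEntropyPolyTail_of_tailPurityFloor : AspectPurityFloor.TailPurityFloor → SlowBitWindow.SubFemtoEntropyPolyTail`
  (⟨stmt-QuantumFields-23742⟩ ⇒ ⟨stmt-QuantumFields-23786⟩).
* `subFemtoEntropy_of_purityFloors : WindowPurityFloor → TailPurityFloor → SlowBitWindow.SubFemtoEntropy` (⟨23272⟩, regime split at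
  `L = β^a`, as in the landed glue `SlowBitWindow.subFemtoEntropyOfWindowTail`) and the same for the rfl-equal `SwapTwistDeficit.SubFemtoEntropy`.

So the two OPEN cruxes of `AspectPurityFloor` are STRONGER, aspect-½ forms of the aspect-one few-body items (the converse fails: `Σ_k (λ_k/λ₀)^{⌊L/2⌋}`
dominates `Σ_k (λ_k/λ₀)^L` on the same spatial torus, not conversely); their extra strength is exactly what the participation door turns into the
gap-factor structure `(1 + poly·√((λ₁/λ₀)^L))·λ₀^L` of `ThermalTraceWindow.FewBodyEntropy` (K1a), which the aspect-one items cannot reach.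
HONEST FRAMING: `WindowPurityFloor`, `TailPurityFloor`, ⟨23785⟩, ⟨23786⟩, ⟨23272⟩, K1a and the YM mass gap are all OPEN / NOT proved here;
this file only records the implications. No `sorry`, no new axiom, no new definition. [cite: ReedSimonIV1978, Thm. XIII.1] [cite: MontvayMunster1994, (3.145)]
-/

set_option autoImplicit false

noncomputable section

open Summit.QuantumFields.YangMills.Theorems
open Summit.QuantumFields.YangMills.Theorems.FemtoTransferGap

namespace Summit.QuantumFields.YangMills.Theses.AspectPurityFloor

/-- **Few-body at aspect one from the aspect-½ participation ratio** (trace formula; `β ≥ 1`, `L ≥ 4`):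
`Z(L×L³) ≤ (Z(⌊L/2⌋×L³)² / Z(2⌊L/2⌋×L³)) · λ₀^L`. [cite: ReedSimonIV1978, Thm. XIII.1] [cite: MontvayMunster1994, (3.145)] -/
theorem physTrace_le_participation_mul (L : ℕ) [NeZero L] (β : ℝ) (hβ : 1 ≤ β) (hL : 4 ≤ L) :
    TT.physTrace L β L ≤
      TT.physTrace L β (L / 2) ^ 2 / TT.physTrace L β (2 * (L / 2)) * levelValue su2Rep L β 0 ^ L := by
  have hβ0 : 0 < β := by linarith
  set t : ℕ := L / 2 with ht
  have ht2 : 2 ≤ t := by omega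
  have htL : t ≤ L := by omega
  set lam : ℕ → ℝ := fun k => levelValue su2Rep L β k with hlam
  have hl0 : 0 < lam 0 := levelValue_zero_su2Rep_pos L β
  have hlpos : ∀ k, 0 < lam k := fun k => levelValue_su2Rep_pos hβ0 k
  have hanti : ∀ {j k : ℕ}, j ≤ k → lam k ≤ lam j := fun hjk => levelValue_le_of_le hβ0 hjk
  have hSt : HasSum (fun k => lam k ^ t) (TT.physTrace L β t) := TT.traceFormula_all L β t hβ ht2
  have hS2t : HasSum (fun k => lam k ^ (2 * t)) (TT.physTrace L β (2 * t)) :=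
    TT.traceFormula_all L β (2 * t) hβ (by omega)
  have hSL : HasSum (fun k => lam k ^ L) (TT.physTrace L β L) := TT.traceFormula_all L β L hβ (by omega)
  set Zt : ℝ := TT.physTrace L β t with hZt
  set Z2t : ℝ := TT.physTrace L β (2 * t) with hZ2t
  set ZL : ℝ := TT.physTrace L β L with hZL
  have hZ2t_ge : lam 0 ^ (2 * t) ≤ Z2t := le_hasSum hS2t 0 (fun j _ => pow_nonneg (hlpos j).le _)
  have hZ2t_pos : 0 < Z2t := lt_of_lt_of_le (pow_pos hl0 _) hZ2t_ge
  have hZt_ge : lam 0 ^ t ≤ Zt := le_hasSum hSt 0 (fun j _ => pow_nonneg (hlpos j).le _)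
  have hZt_pos : 0 < Zt := lt_of_lt_of_le (pow_pos hl0 _) hZt_ge
  -- (1) `Z(2t) ≤ λ₀^t Z(t)`
  have h1 : Z2t ≤ lam 0 ^ t * Zt := by
    have hg : HasSum (fun k => lam 0 ^ t * lam k ^ t) (lam 0 ^ t * Zt) := hSt.mul_left _
    refine hasSum_le (fun k => ?_) hS2t hg
    have hsq : lam k ^ (2 * t) = lam k ^ t * lam k ^ t := by rw [two_mul, pow_add]
    rw [hsq]
    exact mul_le_mul_of_nonneg_right (pow_le_pow_left₀ (hlpos k).le (hanti (Nat.zero_le k)) _)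
      (pow_nonneg (hlpos k).le _)
  -- (2) `Z(L) ≤ λ₀^{L-t} Z(t)` (termwise)
  have h2 : ZL ≤ lam 0 ^ (L - t) * Zt := by
    have hg : HasSum (fun k => lam 0 ^ (L - t) * lam k ^ t) (lam 0 ^ (L - t) * Zt) := hSt.mul_left _
    refine hasSum_le (fun k => ?_) hSL hg
    have hsplit : lam k ^ L = lam k ^ (L - t) * lam k ^ t := by rw [← pow_add]; congr 1; omega
    rw [hsplit]
    exact mul_le_mul_of_nonneg_right (pow_le_pow_left₀ (hlpos k).le (hanti (Nat.zero_le k)) _)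
      (pow_nonneg (hlpos k).le _)
  -- (3) `Z(t) ≤ (Z(t)²/Z(2t)) λ₀^t`
  have hl0t : 0 < lam 0 ^ t := pow_pos hl0 _
  have h3 : Zt ≤ Zt ^ 2 / Z2t * lam 0 ^ t := by
    have key : Zt * Z2t ≤ Zt ^ 2 * lam 0 ^ t := by
      calc Zt * Z2t ≤ Zt * (lam 0 ^ t * Zt) := mul_le_mul_of_nonneg_left h1 hZt_pos.le
        _ = Zt ^ 2 * lam 0 ^ t := by ring
    have hre : Zt ^ 2 / Z2t * lam 0 ^ t = Zt ^ 2 * lam 0 ^ t / Z2t := by ring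
    rw [hre, le_div_iff₀ hZ2t_pos]
    exact key
  -- (4) combine
  have hLsplit : lam 0 ^ L = lam 0 ^ (L - t) * lam 0 ^ t := by rw [← pow_add]; congr 1; omega
  calc ZL ≤ lam 0 ^ (L - t) * Zt := h2
    _ ≤ lam 0 ^ (L - t) * (Zt ^ 2 / Z2t * lam 0 ^ t) := mul_le_mul_of_nonneg_left h3 (pow_nonneg hl0.le _)
    _ = Zt ^ 2 / Z2t * (lam 0 ^ (L - t) * lam 0 ^ t) := by ring
    _ = Zt ^ 2 / Z2t * lam 0 ^ L := by rw [hLsplit]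

/-- From `Z(t)² ≤ K·Z(2t)` (`K ≥ 0`) and `Z(2t) > 0`: the participation ratio is at most `K`. [folklore] -/
theorem participation_le_of_sq_le {L : ℕ} [NeZero L] {β : ℝ} (hβ : 1 ≤ β) (hL : 4 ≤ L) {K : ℝ}
    (h : TT.physTrace L β (L / 2) ^ 2 ≤ K * TT.physTrace L β (2 * (L / 2))) :
    TT.physTrace L β (L / 2) ^ 2 / TT.physTrace L β (2 * (L / 2)) ≤ K := by
  have hβ0 : 0 < β := by linarith
  have hS2t : HasSum (fun k => levelValue su2Rep L β k ^ (2 * (L / 2))) (TT.physTrace L β (2 * (L / 2))) :=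
    TT.traceFormula_all L β (2 * (L / 2)) hβ (by omega)
  have hZ2t_pos : 0 < TT.physTrace L β (2 * (L / 2)) :=
    lt_of_lt_of_le (pow_pos (levelValue_zero_su2Rep_pos L β) _)
      (le_hasSum hS2t 0 (fun j _ => pow_nonneg (levelValue_su2Rep_pos hβ0 j).le _))
  rw [div_le_iff₀ hZ2t_pos]
  exact h

/-- Monomial bookkeeping: for `β ≥ max 1 C`, `1 ≤ L ≤ β^A`: `C β^q L^p ≤ β^(1 + max q 0 + A · max p 0)`. [folklore] -/
theorem poly_le_rpow {C q p A β : ℝ} {L : ℕ} (hβ1 : 1 ≤ β) (hβC : C ≤ β)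
    (hL1 : 1 ≤ L) (hLA : (L : ℝ) ≤ β ^ A) :
    C * β ^ q * (L : ℝ) ^ p ≤ β ^ (1 + max q 0 + A * max p 0) := by
  have hβ0 : 0 < β := by linarith
  have hL1' : (1 : ℝ) ≤ (L : ℝ) := by exact_mod_cast hL1
  have hL0 : (0 : ℝ) < (L : ℝ) := by linarith
  have hq : β ^ q ≤ β ^ (max q 0) := Real.rpow_le_rpow_of_exponent_le hβ1 (le_max_left _ _)
  have hp : (L : ℝ) ^ p ≤ (L : ℝ) ^ (max p 0) := Real.rpow_le_rpow_of_exponent_le hL1' (le_max_left _ _)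
  have hp' : (L : ℝ) ^ (max p 0) ≤ (β ^ A) ^ (max p 0) :=
    Real.rpow_le_rpow hL0.le hLA (le_max_right _ _)
  have hp'' : (β ^ A) ^ (max p 0) = β ^ (A * max p 0) := by rw [← Real.rpow_mul hβ0.le]
  have hC' : C ≤ β ^ (1 : ℝ) := by rw [Real.rpow_one]; exact hβC
  calc C * β ^ q * (L : ℝ) ^ p ≤ β ^ (1 : ℝ) * β ^ (max q 0) * β ^ (A * max p 0) := by
        rw [← hp'']
        apply mul_le_mul (mul_le_mul hC' hq (Real.rpow_nonneg hβ0.le _) (Real.rpow_nonneg hβ0.le _))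
          (hp.trans hp') (Real.rpow_nonneg hL0.le _)
        exact mul_nonneg (Real.rpow_nonneg hβ0.le _) (Real.rpow_nonneg hβ0.le _)
    _ = β ^ (1 + max q 0 + A * max p 0) := by
        rw [← Real.rpow_add hβ0, ← Real.rpow_add hβ0]

/-- ★ **⟨23743⟩ ⇒ ⟨23785⟩**: the aspect-½ purity floor on the window implies few-body entropy at aspect one on the (same) window.
[cite: ReedSimonIV1978, Thm. XIII.1] -/
theorem subFemtoEntropyLaplaceWindow_of_windowPurityFloor (hW : WindowPurityFloor) :
    Summit.QuantumFields.YangMills.Theses.SlowBitWindow.SubFemtoEntropyLaplaceWindow := by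
  obtain ⟨a, ha, C, q, p, β₁, hC, L₀, hWin⟩ := hW
  refine ⟨a, ha, 1 + max q 0 + a * max p 0, max β₁ (max 1 C), max L₀ 4, fun β hβ L _ hL₀ hLa => ?_⟩
  have hβ₁ : β₁ ≤ β := le_trans (le_max_left _ _) hβ
  have hβ1 : 1 ≤ β := le_trans (le_trans (le_max_left _ _) (le_max_right _ _)) hβ
  have hβC : C ≤ β := le_trans (le_trans (le_max_right _ _) (le_max_right _ _)) hβ
  have hL4 : 4 ≤ L := le_trans (le_max_right _ _) hL₀
  have hLL₀ : L₀ ≤ L := le_trans (le_max_left _ _) hL₀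
  have hP := participation_le_of_sq_le hβ1 hL4 (hWin β hβ₁ L hLL₀ hLa)
  have hpoly := poly_le_rpow (q := q) (p := p) (A := a) hβ1 hβC (by omega) hLa
  have hl0 : 0 ≤ levelValue su2Rep L β 0 ^ L := pow_nonneg (levelValue_zero_su2Rep_pos L β).le _
  calc TT.physTrace L β L
      ≤ TT.physTrace L β (L / 2) ^ 2 / TT.physTrace L β (2 * (L / 2)) * levelValue su2Rep L β 0 ^ L :=
        physTrace_le_participation_mul L β hβ1 hL4
    _ ≤ β ^ (1 + max q 0 + a * max p 0) * levelValue su2Rep L β 0 ^ L :=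
        mul_le_mul_of_nonneg_right (hP.trans hpoly) hl0

/-- ★ **⟨23742⟩ ⇒ ⟨23786⟩**: the aspect-½ purity floor beyond the window implies few-body entropy at aspect one on every poly tail
`β^a ≤ L ≤ β^A`. [cite: ReedSimonIV1978, Thm. XIII.1] -/
theorem subFemtoEntropyPolyTail_of_tailPurityFloor (hT : TailPurityFloor) :
    Summit.QuantumFields.YangMills.Theses.SlowBitWindow.SubFemtoEntropyPolyTail := by
  intro a ha A hA
  obtain ⟨C, q, p, β₁, hC, hTail⟩ := hT a ha
  refine ⟨1 + max q 0 + A * max p 0, max β₁ (max 1 C), 4, fun β hβ L _ hL4 haL hLA => ?_⟩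
  have hβ₁ : β₁ ≤ β := le_trans (le_max_left _ _) hβ
  have hβ1 : 1 ≤ β := le_trans (le_trans (le_max_left _ _) (le_max_right _ _)) hβ
  have hβC : C ≤ β := le_trans (le_trans (le_max_right _ _) (le_max_right _ _)) hβ
  have hP := participation_le_of_sq_le hβ1 hL4 (hTail β hβ₁ L hL4 haL)
  have hpoly := poly_le_rpow (q := q) (p := p) (A := A) hβ1 hβC (by omega) hLA
  have hl0 : 0 ≤ levelValue su2Rep L β 0 ^ L := pow_nonneg (levelValue_zero_su2Rep_pos L β).le _
  calc TT.physTrace L β L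
      ≤ TT.physTrace L β (L / 2) ^ 2 / TT.physTrace L β (2 * (L / 2)) * levelValue su2Rep L β 0 ^ L :=
        physTrace_le_participation_mul L β hβ1 hL4
    _ ≤ β ^ (1 + max q 0 + A * max p 0) * levelValue su2Rep L β 0 ^ L :=
        mul_le_mul_of_nonneg_right (hP.trans hpoly) hl0

/-- ★ **⟨23743⟩ ∧ ⟨23742⟩ ⇒ ⟨23272⟩** (`SlowBitWindow.SubFemtoEntropy`, all windows `L ≤ β^A`): regime split at `L = β^a`
(the same bookkeeping as the landed glue `SlowBitWindow.subFemtoEntropyOfWindowTail`, inlined to keep this module's imports route-file-only).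
[cite: ReedSimonIV1978, Thm. XIII.1] -/
theorem subFemtoEntropy_of_purityFloors (hW : WindowPurityFloor) (hT : TailPurityFloor) :
    Summit.QuantumFields.YangMills.Theses.SlowBitWindow.SubFemtoEntropy := by
  intro A hA
  obtain ⟨a, ha, q₁, β₁, L₁, h₁⟩ := subFemtoEntropyLaplaceWindow_of_windowPurityFloor hW
  obtain ⟨q₂, β₂, L₂, h₂⟩ := subFemtoEntropyPolyTail_of_tailPurityFloor hT a ha A hA
  refine ⟨max q₁ q₂, max (max β₁ β₂) 1, max L₁ L₂, fun β hβ L _ hL hLA => ?_⟩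
  have hβ1 : 1 ≤ β := le_trans (le_max_right _ _) hβ
  have hb1 : β₁ ≤ β := le_trans (le_trans (le_max_left _ _) (le_max_left _ _)) hβ
  have hb2 : β₂ ≤ β := le_trans (le_trans (le_max_right _ _) (le_max_left _ _)) hβ
  have hl0 : 0 ≤ levelValue su2Rep L β 0 ^ L := pow_nonneg (levelValue_zero_su2Rep_pos L β).le _
  rcases le_or_gt (L : ℝ) (β ^ a) with hLa | hLa
  · calc TT.physTrace L β L ≤ β ^ q₁ * levelValue su2Rep L β 0 ^ L :=
          h₁ β hb1 L (le_trans (le_max_left _ _) hL) hLa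
      _ ≤ β ^ (max q₁ q₂) * levelValue su2Rep L β 0 ^ L :=
          mul_le_mul_of_nonneg_right (Real.rpow_le_rpow_of_exponent_le hβ1 (le_max_left _ _)) hl0
  · calc TT.physTrace L β L ≤ β ^ q₂ * levelValue su2Rep L β 0 ^ L :=
          h₂ β hb2 L (le_trans (le_max_right _ _) hL) hLa.le hLA
      _ ≤ β ^ (max q₁ q₂) * levelValue su2Rep L β 0 ^ L :=
          mul_le_mul_of_nonneg_right (Real.rpow_le_rpow_of_exponent_le hβ1 (le_max_right _ _)) hl0

/-- The same for the rfl-equal shared decl `SwapTwistDeficit.SubFemtoEntropy`. [cite: ReedSimonIV1978, Thm. XIII.1] -/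
theorem swapTwistDeficit_subFemtoEntropy_of_purityFloors (hW : WindowPurityFloor) (hT : TailPurityFloor) :
    Summit.QuantumFields.YangMills.Theses.SwapTwistDeficit.SubFemtoEntropy :=
  subFemtoEntropy_of_purityFloors hW hT

end Summit.QuantumFields.YangMills.Theses.AspectPurityFloor

end
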